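import Literature.Barriers.QuantumAdvantage.TQBFSavitch
import Literature.Barriers.QuantumAdvantage.TQBFFlatCoding
import Literature.Computability.Complexity.TautCertificates
import HarnessLib

/-!
# `TQBF` is `PSPACE`-hard, III: the one-step formula of a flat program and the reduction's correctness

Arora–Barak 2009, Thm. 4.13, second half of the proof (with §4.1.1, Claim 4.4: a formula
`φ_{M,x}(C, C')` that holds "iff `C` and `C'` encode two adjacent configurations"). For the
tree's flattened `PSPACE` machines (`FlatProg.FlatWitness`, `SpaceMachinesFlat.lean`) and the
one-hot coding of part II (`TQBFFlatCoding.lean`), this file writes the one-step relation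
`C' = step P C` as a propositional formula and plugs it into the Savitch formula of part I
(`TQBFSavitch.lean`):

* templates: a formula `T` over the variables `0 … 2n-1` (block `X` = `0 … n-1`, block
  `Y` = `n … 2n-1`) gives the two-block formula `ofTpl n T a b` of part I's interface
  (`eval_ofTpl`: its value is `T` at `wordAssign n (readVec σ a n) (readVec σ b n)`;
  `propFormVarBound_ofTpl_le`); likewise `ofTpl₁` for one block;
* `stepTpl Λ P` — for each counter value `p ≤ H` the guard `X.pc = p` implies: for `goto j`,
  `Y.pc = j` and all stacks equal; for `push k a j`, `Y.pc = j`, the other stacks equal, cell `0`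
  of stack `k` holds `a`, the other cells are the cells of `X` shifted down by one; for `pop k t`,
  the cells shifted up with an empty last cell, the other stacks equal, and `Y.pc = t[v]` where
  `v` is the value of the top cell of `X`; for `p = H` (halted) `Y = X`. All of these are block
  equalities (`vecEq`/`vecConst` of part I), so the formula has size `O(H · Nc)` and no
  auxiliary variables;
* **`stepTpl_iff`**: on the coding of a valid configuration `c` whose successor is valid,
  `stepTpl` holds of `(enc c, Y)` iff `Y = enc (step P c)` — Claim 4.4 for flat programs, in
  the deterministic form; hence `reach_iff`: the doubling relation `Reach` of part I holds of
  `(enc c, Y)` at level `ℓ` iff `Y = enc (step^[2^ℓ] c)`;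
* `accTpl` (the output stack reads `[acc]`), and the end-to-end statement
  **`FlatWitness.mem_iff_isTrue`**: for a flat witness `W` of `L` and the layout
  `W.lay n = (|P|, K, N, bound n + 2)`, `x ∈ L` iff the Savitch formula over `stepTpl`/`accTpl`
  from `enc (initial configuration of x)` with `Nc` levels is true — because the run is valid
  throughout, halts within `2^{Nc}` steps (the configurations before halting are pairwise
  distinct and injectively coded by `Nc` bits, `haltTime_le`), and is frozen afterwards; and
  `isClosed_flatQBF`.

Part IV emits the code of this formula in polynomial time, giving `L ≤ₚ TQBF`.

## References

* S. Arora, B. Barak, *Computational Complexity: A Modern Approach*, CUP 2009, Thm. 4.13 (proof,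
  second half), §4.1.1 and Claim 4.4, Thm. 4.2/Rem. 4.3 (a halting space-bounded run takes at
  most `2^{O(S)}` steps: configurations do not repeat) [AroraBarakCC2009].
-/

namespace Literature.Barriers.QuantumAdvantage

open Literature.Computability.Complexity Literature.Computability.Complexity.FlatProg

namespace TQBFRed

/-! ### Templates over one and two blocks -/

/-- The assignment of the template variables from two words: `v < n ↦ X[v]`, `n + v ↦ Y[v]`.
[folklore] -/
def wordAssign (n : ℕ) (X Y : List Bool) (v : ℕ) : Bool :=
  if v < n then X.getD v false else Y.getD (v - n) false

/-- The renaming of the template variables to the blocks at bases `a` and `b`. [folklore] -/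
def remap (n a b : ℕ) (v : ℕ) : ℕ := if v < n then a + v else b + (v - n)

/-- **The two-block formula of a template** `T` (variables `0 … 2n-1`) at bases `a`, `b`. [folklore] -/
def ofTpl (n : ℕ) (T : PropForm ℕ) (a b : ℕ) : PropForm ℕ := T.mapVars (remap n a b)

/-- The one-block formula of a template `A` (variables `0 … n-1`) at base `a`. [folklore] -/
def ofTpl₁ (A : PropForm ℕ) (a : ℕ) : PropForm ℕ := A.mapVars (a + ·)

/-- Entries of a read word, defaulting. [folklore] -/
theorem getD_readVec (σ : ℕ → Bool) (a n : ℕ) {v : ℕ} (hv : v < n) : (readVec σ a n).getD v false = σ (a + v) := by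
  rw [List.getD_eq_getElem _ _ (by simpa using hv), getElem_readVec]

/-- **Value of the two-block formula**: the template at the two read words. [folklore] -/
theorem eval_ofTpl {n : ℕ} {T : PropForm ℕ} (hT : propFormVarBound T ≤ 2 * n) (σ : ℕ → Bool) (a b : ℕ) :
    (ofTpl n T a b).eval σ = T.eval (wordAssign n (readVec σ a n) (readVec σ b n)) := by
  rw [ofTpl, PropForm.eval_mapVars]
  refine propForm_eval_congr fun v hv => ?_
  simp only [Function.comp_apply, remap, wordAssign]
  split
  · rw [getD_readVec _ _ _ (by assumption)]
  · rw [getD_readVec _ _ _ (by omega)]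

/-- Value of the one-block formula. [folklore] -/
theorem eval_ofTpl₁ {n : ℕ} {A : PropForm ℕ} (hA : propFormVarBound A ≤ n) (σ : ℕ → Bool) (a : ℕ) :
    (ofTpl₁ A a).eval σ = A.eval (fun v => (readVec σ a n).getD v false) := by
  rw [ofTpl₁, PropForm.eval_mapVars]
  refine propForm_eval_congr fun v hv => ?_
  rw [Function.comp_apply, getD_readVec _ _ _ (by omega)]

/-- Variable bound of a renamed formula. [folklore] -/
theorem propFormVarBound_mapVars_le {φ : PropForm ℕ} {f : ℕ → ℕ} {B : ℕ} (h : ∀ v < propFormVarBound φ, f v < B) :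
    propFormVarBound (φ.mapVars f) ≤ B := by
  induction φ with
  | var v => exact h v (by simp [propFormVarBound])
  | const b => exact Nat.zero_le _
  | neg φ ih => exact ih h
  | conj φ ψ ih₁ ih₂ =>
    simp only [PropForm.mapVars, propFormVarBound, max_le_iff]
    exact ⟨ih₁ fun v hv => h v (by simp [propFormVarBound]; omega), ih₂ fun v hv => h v (by simp [propFormVarBound]; omega)⟩
  | disj φ ψ ih₁ ih₂ =>
    simp only [PropForm.mapVars, propFormVarBound, max_le_iff]
    exact ⟨ih₁ fun v hv => h v (by simp [propFormVarBound]; omega), ih₂ fun v hv => h v (by simp [propFormVarBound]; omega)⟩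

/-- Variable bound of the two-block formula. [folklore] -/
theorem propFormVarBound_ofTpl_le {n : ℕ} {T : PropForm ℕ} (hT : propFormVarBound T ≤ 2 * n) (a b : ℕ) :
    propFormVarBound (ofTpl n T a b) ≤ max (a + n) (b + n) :=
  propFormVarBound_mapVars_le fun v hv => by
    simp only [remap]
    split <;> omega

/-- Variable bound of the one-block formula. [folklore] -/
theorem propFormVarBound_ofTpl₁_le {n : ℕ} {A : PropForm ℕ} (hA : propFormVarBound A ≤ n) (a : ℕ) :
    propFormVarBound (ofTpl₁ A a) ≤ a + n :=
  propFormVarBound_mapVars_le fun v hv => by omega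

/-! ### Reading the word assignment -/

/-- Template variables of the first block read `X`. [folklore] -/
theorem wordAssign_of_lt {n : ℕ} (X Y : List Bool) {v : ℕ} (hv : v < n) : wordAssign n X Y v = X.getD v false := by
  simp [wordAssign, hv]

/-- A block read inside `X`. [folklore] -/
theorem readVec_wordAssign_left {n : ℕ} {X : List Bool} (hX : X.length = n) (Y : List Bool) {a m : ℕ}
    (h : a + m ≤ n) : readVec (wordAssign n X Y) a m = sl X a m := by
  refine List.ext_getElem (by rw [length_readVec, length_sl (by omega)]) fun j hj _ => ?_
  rw [length_readVec] at hj
  rw [getElem_readVec, wordAssign_of_lt _ _ (by omega), List.getD_eq_getElem _ _ (by omega)]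
  simp [sl, List.getElem_drop, List.getElem_take]

/-- A block read inside `Y`. [folklore] -/
theorem readVec_wordAssign_right {n : ℕ} (X : List Bool) {Y : List Bool} (hY : Y.length = n) {a m : ℕ}
    (h : a + m ≤ n) : readVec (wordAssign n X Y) (n + a) m = sl Y a m := by
  refine List.ext_getElem (by rw [length_readVec, length_sl (by omega)]) fun j hj _ => ?_
  rw [length_readVec] at hj
  rw [getElem_readVec]
  simp only [wordAssign, show ¬ (n + a + j < n) by omega, if_false, show n + a + j - n = a + j by omega]
  rw [List.getD_eq_getElem _ _ (by omega)]
  simp [sl, List.getElem_drop, List.getElem_take]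

/-- The full `Y` block. [folklore] -/
theorem readVec_wordAssign_right₀ {n : ℕ} (X : List Bool) {Y : List Bool} (hY : Y.length = n) {m : ℕ} (h : m ≤ n) :
    readVec (wordAssign n X Y) n m = sl Y 0 m := by
  have := readVec_wordAssign_right X hY (a := 0) (m := m) (by simpa using h)
  rwa [Nat.add_zero] at this

/-! ### The step template -/

section Step

variable (Λ : Lay) (P : Prog)

/-- `Y.pc = j` (one-hot), for the block at `base`. [cite: AroraBarakCC2009, Thm. 4.13 (proof) and Claim 4.4] -/
def pcIs (base j : ℕ) : PropForm ℕ := vecConst base (onehot (Λ.H + 1) j)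

/-- All stacks of `Y` equal those of `X`. [folklore] -/
def allRegsEq : PropForm ℕ := vecEq (Λ.Nc + (Λ.H + 1)) (Λ.H + 1) (Λ.K * Λ.Wr)

/-- The stacks before stack `k` are equal. [folklore] -/
def beforeEq (k : ℕ) : PropForm ℕ := vecEq (Λ.Nc + (Λ.H + 1)) (Λ.H + 1) (k * Λ.Wr)

/-- The stacks after stack `k` are equal. [folklore] -/
def afterEq (k : ℕ) : PropForm ℕ := vecEq (Λ.Nc + Λ.off (k + 1) 0) (Λ.off (k + 1) 0) ((Λ.K - k - 1) * Λ.Wr)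

/-- The constraint of one instruction. [cite: AroraBarakCC2009, Claim 4.4 (adjacent configurations) and Thm. 4.13] -/
def caseInstr : Instr → PropForm ℕ
  | .goto j => .conj (pcIs Λ Λ.Nc j) (allRegsEq Λ)
  | .push k a j =>
    if k < Λ.K then
      .conj (pcIs Λ Λ.Nc j) (.conj (beforeEq Λ k) (.conj (vecConst (Λ.Nc + Λ.off k 0) (onehot Λ.Wc (a + 1)))
        (.conj (vecEq (Λ.Nc + (Λ.off k 0 + Λ.Wc)) (Λ.off k 0) ((Λ.cap - 1) * Λ.Wc)) (afterEq Λ k))))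
    else .conj (pcIs Λ Λ.Nc j) (allRegsEq Λ)
  | .pop k t =>
    if k < Λ.K then
      .conj (beforeEq Λ k) (.conj (vecEq (Λ.Nc + Λ.off k 0) (Λ.off k 0 + Λ.Wc) ((Λ.cap - 1) * Λ.Wc))
        (.conj (vecConst (Λ.Nc + (Λ.off k 0 + (Λ.cap - 1) * Λ.Wc)) (onehot Λ.Wc 0)) (.conj (afterEq Λ k)
          (bigConj ((List.range Λ.Wc).map fun v => impF (.var (Λ.off k 0 + v)) (pcIs Λ Λ.Nc (t.getD v 0)))))))
    else .conj (pcIs Λ Λ.Nc (t.getD 0 0)) (allRegsEq Λ)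

/-- The constraint at counter value `p`: its instruction, or `Y = X` when halted. [folklore] -/
def caseAt (p : ℕ) : PropForm ℕ :=
  match P[p]? with
  | some i => caseInstr Λ i
  | none => vecEq Λ.Nc 0 Λ.Nc

/-- **The step template**: for every counter value `p ≤ H`, `X.pc = p` implies the constraint
at `p`. [cite: AroraBarakCC2009, Claim 4.4 and Thm. 4.13 (proof: φ_{M,x}(C, C'))] -/
def stepTpl : PropForm ℕ := bigConj ((List.range (Λ.H + 1)).map fun p => impF (.var p) (caseAt Λ P p))

/-! ### Semantics of the step template -/

variable {Λ P}

/-- Bits of the counter part. [folklore] -/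
theorem getD_enc_pc (c : Cfg) {p : ℕ} (hp : p ≤ Λ.H) : (Λ.enc c).getD p false = decide (c.1 = p) := by
  rw [Lay.enc, List.getD_eq_getElem _ _ (by simp; omega), List.getElem_append_left (by simp; omega)]
  simp [Lay.pcPart, getElem_onehot]

/-- The step template fires exactly the constraint at the current counter. [folklore] -/
theorem eval_stepTpl_iff {c : Cfg} (hc : c.1 ≤ Λ.H) (Y : List Bool) :
    (stepTpl Λ P).eval (wordAssign Λ.Nc (Λ.enc c) Y) = true ↔ (caseAt Λ P c.1).eval (wordAssign Λ.Nc (Λ.enc c) Y) = true := by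
  rw [stepTpl, eval_bigConj]
  simp only [List.forall_mem_map, List.mem_range, eval_impF, PropForm.eval]
  constructor
  · intro h
    refine h c.1 (Nat.lt_succ_of_le hc) ?_
    rw [wordAssign_of_lt _ _ (by simp [Lay.Nc]; omega), getD_enc_pc c hc]
    simp
  · intro h p hp hx
    rw [wordAssign_of_lt _ _ (by simp [Lay.Nc]; omega), getD_enc_pc c (by omega), decide_eq_true_eq] at hx
    rwa [← hx]

end Step

/-! ### Slices of the coding -/

section Slices

variable {Λ : Lay}

/-- A word of the right length is a concatenation iff its two slices are the pieces. [folklore] -/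
theorem eq_append₂_iff {α : Type} {Y A B : List α} (h : Y.length = A.length + B.length) :
    Y = A ++ B ↔ sl Y 0 A.length = A ∧ sl Y A.length B.length = B := by
  constructor
  · rintro rfl
    exact ⟨sl_append_zero _ _, by rw [sl_append_at, sl_zero_length]⟩
  · rintro ⟨hA, hB⟩
    have e1 : Y = A ++ Y.drop A.length := by
      conv_lhs => rw [← sl_zero_append_drop Y A.length]
      rw [hA]
    have e2 : Y.drop A.length = B := by
      have ht : (Y.drop A.length).take B.length = Y.drop A.length := List.take_of_length_le (by simp [h])
      rw [← ht]
      exact hB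
    rw [e1, e2]

/-- A slice from `0` is a prefix. [folklore] -/
theorem sl_zero (Y : List Bool) (n : ℕ) : sl Y 0 n = Y.take n := by simp [sl]

/-- Entries of a slice. [folklore] -/
theorem getD_sl (Y : List Bool) {p n v : ℕ} (hv : v < n) (hp : p + n ≤ Y.length) :
    (sl Y p n).getD v false = Y.getD (p + v) false := by
  rw [List.getD_eq_getElem _ _ (by rw [length_sl hp]; exact hv), List.getD_eq_getElem _ _ (by omega)]
  simp [sl, List.getElem_drop, List.getElem_take]

/-- The counter slice of the coding. [folklore] -/
theorem sl_enc_pc (c : Cfg) : sl (Λ.enc c) 0 (Λ.H + 1) = onehot (Λ.H + 1) c.1 := by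
  have hA : (Λ.pcPart c).length = Λ.H + 1 := by simp
  conv_lhs => rw [Lay.enc, ← hA, sl_append_zero]
  rfl

/-- The stacks slice of the coding. [folklore] -/
theorem sl_enc_regs (c : Cfg) : sl (Λ.enc c) (Λ.H + 1) (Λ.K * Λ.Wr) = Λ.regs c.2 (List.range Λ.K) := by
  have hA : (Λ.pcPart c).length = Λ.H + 1 := by simp
  have hB : (Λ.regs c.2 (List.range Λ.K)).length = Λ.K * Λ.Wr := by simp
  rw [Lay.enc, ← hA, sl_append_at, ← hB, sl_zero_length]

/-- The slice of the stacks before stack `k`. [folklore] -/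
theorem sl_enc_before (c : Cfg) {k : ℕ} (hk : k < Λ.K) :
    sl (Λ.enc c) (Λ.H + 1) (k * Λ.Wr) = Λ.regs c.2 (List.range' 0 k) := by
  have hA : (Λ.pcPart c).length = Λ.H + 1 := by simp
  have hB : (Λ.regs c.2 (List.range' 0 k)).length = k * Λ.Wr := by simp
  rw [Λ.enc_eq_append c hk, List.append_assoc, List.append_assoc, ← hA, sl_append_at, ← hB, sl_append_zero]

/-- The start of stack `k` in the coding. [folklore] -/
theorem off_zero_eq_lengths (c : Cfg) (k : ℕ) :
    Λ.off k 0 = (Λ.pcPart c).length + (Λ.regs c.2 (List.range' 0 k)).length := by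
  simp [Lay.off_zero]

/-- A prefix of the region of stack `k` as a slice of the coding. [folklore] -/
theorem sl_enc_reg_take (c : Cfg) {k : ℕ} (hk : k < Λ.K) {n : ℕ} (hn : n ≤ Λ.Wr) :
    sl (Λ.enc c) (Λ.off k 0) n = (Λ.reg c.2 k).take n := by
  rw [Λ.enc_eq_append c hk, List.append_assoc, List.append_assoc, off_zero_eq_lengths c k, sl_append_add, sl_append_at,
    sl_append_left (by simpa using hn), sl_zero]

/-- The region of stack `k` without its first cell, as a slice of the coding. [folklore] -/
theorem sl_enc_reg_drop (c : Cfg) {k : ℕ} (hk : k < Λ.K) (hcap : 1 ≤ Λ.cap) :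
    sl (Λ.enc c) (Λ.off k 0 + Λ.Wc) ((Λ.cap - 1) * Λ.Wc) = (Λ.reg c.2 k).drop Λ.Wc := by
  have hWr : Λ.Wc + (Λ.cap - 1) * Λ.Wc = Λ.Wr := by
    rw [Lay.Wr]
    conv_rhs => rw [show Λ.cap = (Λ.cap - 1) + 1 by omega]
    ring
  rw [Λ.enc_eq_append c hk, List.append_assoc, List.append_assoc, off_zero_eq_lengths c k, Nat.add_assoc, sl_append_add,
    sl_append_add, sl_append_left (by simp [hWr]), sl, List.take_of_length_le (by simp [← hWr])]

/-- The slice of the stacks after stack `k`. [folklore] -/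
theorem sl_enc_after (c : Cfg) {k : ℕ} (hk : k < Λ.K) :
    sl (Λ.enc c) (Λ.off (k + 1) 0) ((Λ.K - k - 1) * Λ.Wr) = Λ.regs c.2 (List.range' (k + 1) (Λ.K - k - 1)) := by
  have h3 : Λ.off (k + 1) 0 = (Λ.pcPart c).length + ((Λ.regs c.2 (List.range' 0 k)).length + (Λ.reg c.2 k).length) := by
    simp [Lay.off_zero]; ring
  have hE : (Λ.regs c.2 (List.range' (k + 1) (Λ.K - k - 1))).length = (Λ.K - k - 1) * Λ.Wr := by simp
  rw [Λ.enc_eq_append c hk, List.append_assoc, List.append_assoc, h3, sl_append_add, sl_append_add, sl_append_at,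
    ← hE, sl_zero_length]

/-- The first cell of the region of stack `k`. [folklore] -/
theorem take_reg_Wc (S : List (List ℕ)) (k : ℕ) (hcap : 1 ≤ Λ.cap) :
    (Λ.reg S k).take Λ.Wc = onehot Λ.Wc (cellVal (S.getD k []) 0) := by
  rw [Lay.reg, show Λ.cap = (Λ.cap - 1) + 1 by omega, List.range_succ_eq_map, List.map_cons, List.flatten_cons,
    List.take_left' (length_onehot _ _)]

/-- **The bits of the top cell of stack `k`** in the coding. [folklore] -/
theorem getD_enc_cell₀ (c : Cfg) {k : ℕ} (hk : k < Λ.K) (hcap : 1 ≤ Λ.cap) {v : ℕ} (hv : v < Λ.Wc) :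
    (Λ.enc c).getD (Λ.off k 0 + v) false = decide (cellVal (c.2.getD k []) 0 = v) := by
  have hWc : Λ.Wc ≤ Λ.Wr := by
    rw [Lay.Wr]; exact Nat.le_mul_of_pos_left _ hcap
  have hoff : Λ.off k 0 + Λ.Wc ≤ (Λ.enc c).length := by
    rw [Lay.length_enc, Lay.off_zero, Lay.Nc]
    have : (k + 1) * Λ.Wr ≤ Λ.K * Λ.Wr := Nat.mul_le_mul_right _ hk
    rw [Nat.succ_mul] at this
    omega
  rw [← getD_sl (Λ.enc c) hv hoff, sl_enc_reg_take c hk hWc, take_reg_Wc _ _ hcap,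
    List.getD_eq_getElem _ _ (by simpa using hv), getElem_onehot]

end Slices

/-! ### Values of the conjuncts -/

section Conjuncts

variable {Λ : Lay} {X Y : List Bool}

/-- Value of `pcIs` on the `Y` block. [folklore] -/
theorem eval_pcIs_iff (X : List Bool) (hY : Y.length = Λ.Nc) (j : ℕ) :
    (pcIs Λ Λ.Nc j).eval (wordAssign Λ.Nc X Y) = true ↔ sl Y 0 (Λ.H + 1) = onehot (Λ.H + 1) j := by
  rw [pcIs, eval_vecConst, length_onehot, readVec_wordAssign_right₀ X hY (by simp [Lay.Nc])]

/-- Value of a block equality `Y[a, a+m) = X[b, b+m)`. [folklore] -/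
theorem eval_vecEq_iff (hX : X.length = Λ.Nc) (hY : Y.length = Λ.Nc) {a b m : ℕ} (ha : a + m ≤ Λ.Nc) (hb : b + m ≤ Λ.Nc) :
    (vecEq (Λ.Nc + a) b m).eval (wordAssign Λ.Nc X Y) = true ↔ sl Y a m = sl X b m := by
  rw [eval_vecEq, readVec_wordAssign_right X hY ha, readVec_wordAssign_left hX Y hb]

/-- Value of a block constant `Y[a, a+|w|) = w`. [folklore] -/
theorem eval_vecConst_iff (X : List Bool) (hY : Y.length = Λ.Nc) {a : ℕ} {w : List Bool} (ha : a + w.length ≤ Λ.Nc) :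
    (vecConst (Λ.Nc + a) w).eval (wordAssign Λ.Nc X Y) = true ↔ sl Y a w.length = w := by
  rw [eval_vecConst, readVec_wordAssign_right X hY ha]

end Conjuncts

/-! ### The one-step theorem -/

section StepSem

variable {Λ : Lay} {P : Prog}

/-- The constraint at a fetchable counter. [folklore] -/
theorem caseAt_of_some {p : ℕ} {i : Instr} (h : P[p]? = some i) : caseAt Λ P p = caseInstr Λ i := by
  simp [caseAt, h]

/-- The constraint at the halting counter. [folklore] -/
theorem caseAt_of_none {p : ℕ} (h : P[p]? = none) : caseAt Λ P p = vecEq Λ.Nc 0 Λ.Nc := by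
  simp [caseAt, h]

/-- Layout arithmetic: consecutive stack regions. [folklore] -/
theorem off_add_Wr (k : ℕ) : Λ.off k 0 + Λ.Wr = Λ.off (k + 1) 0 := by
  simp [Lay.off_zero]; ring

/-- Layout arithmetic: a region is its first cell and the rest. [folklore] -/
theorem Wc_add_rest (hcap : 1 ≤ Λ.cap) : Λ.Wc + (Λ.cap - 1) * Λ.Wc = Λ.Wr := by
  rw [Lay.Wr]
  conv_rhs => rw [show Λ.cap = (Λ.cap - 1) + 1 by omega]
  ring

/-- Layout arithmetic: the regions after stack `k < K` end at `Nc`. [folklore] -/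
theorem off_succ_add_after {k : ℕ} (hk : k < Λ.K) : Λ.off (k + 1) 0 + (Λ.K - k - 1) * Λ.Wr = Λ.Nc := by
  rw [Lay.off_zero, Lay.Nc, show Λ.K = (k + 1) + (Λ.K - k - 1) by omega, Nat.add_mul]
  simp only [show k + 1 + (Λ.K - k - 1) - k - 1 = Λ.K - k - 1 by omega]
  ring

/-- **No-op on the stacks** (`goto`, and `push`/`pop` at a stack index `≥ K`): the constraint
"`Y.pc = j` and all stacks equal" pins `Y` to the coding of `(j, S')` whenever `S'` has the same
regions as the stacks of `c`. [cite: AroraBarakCC2009, Claim 4.4] -/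
theorem pc_allRegs_iff {Y : List Bool} (hY : Y.length = Λ.Nc) (c : Cfg) (j : ℕ) {S' : List (List ℕ)}
    (hS' : Λ.regs S' (List.range Λ.K) = Λ.regs c.2 (List.range Λ.K)) :
    ((pcIs Λ Λ.Nc j).eval (wordAssign Λ.Nc (Λ.enc c) Y) = true ∧
      (allRegsEq Λ).eval (wordAssign Λ.Nc (Λ.enc c) Y) = true) ↔ Y = Λ.enc (j, S') := by
  have hX : (Λ.enc c).length = Λ.Nc := Λ.length_enc c
  rw [eval_pcIs_iff _ hY, allRegsEq, eval_vecEq_iff hX hY (by simp [Lay.Nc]) (by simp [Lay.Nc]), sl_enc_regs, Lay.enc,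
    eq_append₂_iff (by simp [hY, Lay.Nc])]
  simp only [length_onehot, Lay.length_regs, List.length_range, Lay.pcPart, hS']

/-- The counter conjunct of `pop`: `Y.pc` is the table entry of the top cell of stack `k`.
[cite: AroraBarakCC2009, Claim 4.4] -/
theorem eval_popPc_iff {Y : List Bool} (hY : Y.length = Λ.Nc) (c : Cfg) {k : ℕ} (hk : k < Λ.K) (hcap : 1 ≤ Λ.cap)
    (hb : ∀ a ∈ c.2.getD k [], a ≤ Λ.N) (t : List ℕ) :
    (bigConj ((List.range Λ.Wc).map fun v => impF (.var (Λ.off k 0 + v)) (pcIs Λ Λ.Nc (t.getD v 0)))).eval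
        (wordAssign Λ.Nc (Λ.enc c) Y) = true ↔
      sl Y 0 (Λ.H + 1) = onehot (Λ.H + 1) (t.getD (cellVal (c.2.getD k []) 0) 0) := by
  have hv₀ : cellVal (c.2.getD k []) 0 < Λ.Wc := by
    have := cellVal_le hb 0; simp only [Lay.Wc]; omega
  have hlt : ∀ v < Λ.Wc, Λ.off k 0 + v < Λ.Nc := fun v hv => by
    have h1 := off_add_Wr (Λ := Λ) k
    have h2 := off_succ_add_after hk
    have h3 := Wc_add_rest hcap
    omega
  have hbit : ∀ v < Λ.Wc, wordAssign Λ.Nc (Λ.enc c) Y (Λ.off k 0 + v) = decide (cellVal (c.2.getD k []) 0 = v) :=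
    fun v hv => by rw [wordAssign_of_lt _ _ (hlt v hv), getD_enc_cell₀ c hk hcap hv]
  rw [eval_bigConj]
  simp only [List.forall_mem_map, List.mem_range, eval_impF, PropForm.eval, eval_pcIs_iff _ hY]
  constructor
  · intro h
    exact h _ hv₀ (by rw [hbit _ hv₀]; exact decide_eq_true rfl)
  · intro h v hv hx
    rw [hbit v hv, decide_eq_true_eq] at hx
    rwa [← hx]

/-- **`push k a j` at a stack `k < K`.** [cite: AroraBarakCC2009, Claim 4.4] -/
theorem push_iff {Y : List Bool} (hY : Y.length = Λ.Nc) {c : Cfg} (hcv : Λ.Valid c) (hcap : 1 ≤ Λ.cap)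
    {k a j : ℕ} (hk : k < Λ.K) :
    (caseInstr Λ (.push k a j)).eval (wordAssign Λ.Nc (Λ.enc c) Y) = true ↔ Y = Λ.enc (j, c.2.modify k (a :: ·)) := by
  obtain ⟨pc, S⟩ := c
  obtain ⟨-, hlen, hst⟩ := hcv
  simp only at hlen hst ⊢
  have hX : (Λ.enc (pc, S)).length = Λ.Nc := Λ.length_enc _
  set S' := S.modify k (a :: ·) with hS'
  have hS'k : S'.getD k [] = a :: S.getD k [] := Lay.getD_modify_self S _ (by omega)
  have hbefore : Λ.regs S' (List.range' 0 k) = Λ.regs S (List.range' 0 k) :=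
    Λ.regs_congr fun k' hk' => Lay.getD_modify_of_ne S _ (by rw [List.mem_range'] at hk'; omega)
  have hafter : Λ.regs S' (List.range' (k + 1) (Λ.K - k - 1)) = Λ.regs S (List.range' (k + 1) (Λ.K - k - 1)) :=
    Λ.regs_congr fun k' hk' => Lay.getD_modify_of_ne S _ (by rw [List.mem_range'] at hk'; omega)
  have hreg : Λ.reg S' k = onehot Λ.Wc (a + 1) ++ (Λ.reg S k).take ((Λ.cap - 1) * Λ.Wc) := Λ.reg_cons hS'k rfl hcap
  have henc : Λ.enc (j, S') = onehot (Λ.H + 1) j ++ Λ.regs S (List.range' 0 k) ++ onehot Λ.Wc (a + 1) ++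
      (Λ.reg S k).take ((Λ.cap - 1) * Λ.Wc) ++ Λ.regs S (List.range' (k + 1) (Λ.K - k - 1)) := by
    rw [Λ.enc_eq_append (j, S') hk]
    simp only [Lay.pcPart, hbefore, hreg, hafter, List.append_assoc]
  -- layout arithmetic
  have a1 := off_add_Wr (Λ := Λ) k
  have a2 := off_succ_add_after hk
  have a3 := Wc_add_rest hcap
  have a4 : Λ.off k 0 = Λ.H + 1 + k * Λ.Wr := Λ.off_zero k
  have hle : (Λ.cap - 1) * Λ.Wc ≤ Λ.Wr := by omega
  have hD : ((Λ.reg S k).take ((Λ.cap - 1) * Λ.Wc)).length = (Λ.cap - 1) * Λ.Wc := by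
    rw [List.length_take, Lay.length_reg, Nat.min_eq_left hle]
  have hY5 : Y.length = (onehot (Λ.H + 1) j).length + (Λ.regs S (List.range' 0 k)).length + (onehot Λ.Wc (a + 1)).length +
      ((Λ.reg S k).take ((Λ.cap - 1) * Λ.Wc)).length + (Λ.regs S (List.range' (k + 1) (Λ.K - k - 1))).length := by
    rw [hY, hD, length_onehot, length_onehot, Lay.length_regs, Lay.length_regs, List.length_range', List.length_range']
    omega
  have a5 : Λ.off (k + 1) 0 = Λ.H + 1 + k * Λ.Wr + Λ.Wc + (Λ.cap - 1) * Λ.Wc := by omega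
  rw [caseInstr, if_pos hk]
  simp only [PropForm.eval, Bool.and_eq_true]
  rw [eval_pcIs_iff _ hY, beforeEq, eval_vecEq_iff hX hY (by omega) (by omega),
    eval_vecConst_iff _ hY (by rw [length_onehot]; omega), eval_vecEq_iff hX hY (by omega) (by omega), afterEq,
    eval_vecEq_iff hX hY (by omega) (by omega), sl_enc_before _ hk, length_onehot, sl_enc_reg_take _ hk hle,
    sl_enc_after _ hk, henc, eq_append₅_iff hY5, hD, length_onehot, length_onehot, Lay.length_regs, Lay.length_regs,
    List.length_range', List.length_range', a4, a5]

/-- **`pop k t` at a stack `k < K`.** [cite: AroraBarakCC2009, Claim 4.4] -/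
theorem pop_iff {Y : List Bool} (hY : Y.length = Λ.Nc) {c : Cfg} (hcv : Λ.Valid c) (hcap : 1 ≤ Λ.cap)
    {k : ℕ} {t : List ℕ} (hk : k < Λ.K) :
    (caseInstr Λ (.pop k t)).eval (wordAssign Λ.Nc (Λ.enc c) Y) = true ↔
      Y = Λ.enc (t.getD (tblIdx (c.2.getD k []).head?) 0, c.2.set k (c.2.getD k []).tail) := by
  obtain ⟨pc, S⟩ := c
  obtain ⟨-, hlen, hst⟩ := hcv
  simp only at hlen hst ⊢
  have hX : (Λ.enc (pc, S)).length = Λ.Nc := Λ.length_enc _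
  have hmem : S.getD k [] ∈ S := by
    rw [List.getD_eq_getElem _ _ (by omega)]; exact List.getElem_mem _
  obtain ⟨hl, hb⟩ := hst _ hmem
  set S' := S.set k (S.getD k []).tail with hS'
  have hS'k : S'.getD k [] = (S.getD k []).tail := Lay.getD_set_self S _ (by omega)
  have hbefore : Λ.regs S' (List.range' 0 k) = Λ.regs S (List.range' 0 k) :=
    Λ.regs_congr fun k' hk' => Lay.getD_set_of_ne S _ (by rw [List.mem_range'] at hk'; omega)
  have hafter : Λ.regs S' (List.range' (k + 1) (Λ.K - k - 1)) = Λ.regs S (List.range' (k + 1) (Λ.K - k - 1)) :=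
    Λ.regs_congr fun k' hk' => Lay.getD_set_of_ne S _ (by rw [List.mem_range'] at hk'; omega)
  have hreg : Λ.reg S' k = (Λ.reg S k).drop Λ.Wc ++ onehot Λ.Wc 0 := Λ.reg_tail hS'k rfl hcap hl
  rw [← cellVal_zero_eq_tblIdx]
  set pc' := t.getD (cellVal (S.getD k []) 0) 0 with hpc'
  have henc : Λ.enc (pc', S') = onehot (Λ.H + 1) pc' ++ Λ.regs S (List.range' 0 k) ++ (Λ.reg S k).drop Λ.Wc ++
      onehot Λ.Wc 0 ++ Λ.regs S (List.range' (k + 1) (Λ.K - k - 1)) := by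
    rw [Λ.enc_eq_append (pc', S') hk]
    simp only [Lay.pcPart, hbefore, hreg, hafter, List.append_assoc]
  -- layout arithmetic
  have a1 := off_add_Wr (Λ := Λ) k
  have a2 := off_succ_add_after hk
  have a3 := Wc_add_rest hcap
  have a4 : Λ.off k 0 = Λ.H + 1 + k * Λ.Wr := Λ.off_zero k
  have hC : ((Λ.reg S k).drop Λ.Wc).length = (Λ.cap - 1) * Λ.Wc := by
    rw [List.length_drop, Lay.length_reg]; omega
  have hY5 : Y.length = (onehot (Λ.H + 1) pc').length + (Λ.regs S (List.range' 0 k)).length +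
      ((Λ.reg S k).drop Λ.Wc).length + (onehot Λ.Wc 0).length + (Λ.regs S (List.range' (k + 1) (Λ.K - k - 1))).length := by
    rw [hY, hC, length_onehot, length_onehot, Lay.length_regs, Lay.length_regs, List.length_range', List.length_range']
    omega
  have a5 : Λ.off (k + 1) 0 = Λ.H + 1 + k * Λ.Wr + (Λ.cap - 1) * Λ.Wc + Λ.Wc := by omega
  have a6 : Λ.off k 0 + (Λ.cap - 1) * Λ.Wc = Λ.H + 1 + k * Λ.Wr + (Λ.cap - 1) * Λ.Wc := by omega
  rw [caseInstr, if_pos hk]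
  simp only [PropForm.eval, Bool.and_eq_true]
  rw [beforeEq, eval_vecEq_iff hX hY (by omega) (by omega), eval_vecEq_iff hX hY (by omega) (by omega),
    eval_vecConst_iff _ hY (by rw [length_onehot]; omega), afterEq, eval_vecEq_iff hX hY (by omega) (by omega),
    eval_popPc_iff hY (pc, S) hk hcap hb t, sl_enc_before _ hk, sl_enc_reg_drop _ hk hcap, length_onehot,
    sl_enc_after _ hk, henc, eq_append₅_iff hY5, hC, length_onehot, length_onehot, Lay.length_regs, Lay.length_regs,
    List.length_range', List.length_range', a6, a4, a5]
  constructor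
  · rintro ⟨h₂, h₃, h₄, h₅, h₁⟩; exact ⟨h₁, h₂, h₃, h₄, h₅⟩
  · rintro ⟨h₁, h₂, h₃, h₄, h₅⟩; exact ⟨h₂, h₃, h₄, h₅, h₁⟩

/-- **The halted case**: `Y = X`. [folklore] -/
theorem halt_iff {Y : List Bool} (hY : Y.length = Λ.Nc) (c : Cfg) :
    (vecEq Λ.Nc 0 Λ.Nc).eval (wordAssign Λ.Nc (Λ.enc c) Y) = true ↔ Y = Λ.enc c := by
  have hX : (Λ.enc c).length = Λ.Nc := Λ.length_enc c
  rw [eval_vecEq, readVec_wordAssign_right₀ _ hY le_rfl, readVec_wordAssign_left hX Y (by simp), sl_zero, sl_zero,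
    List.take_of_length_le (by omega), List.take_of_length_le (by omega)]

/-- **Claim 4.4 for flat programs, deterministic form**: on the coding of a valid configuration,
the step template holds of `(enc c, Y)` iff `Y` is the coding of the successor configuration.
[cite: AroraBarakCC2009, Claim 4.4 and Thm. 4.13 (proof: φ_{M,x})] -/
theorem stepTpl_iff (hcap : 1 ≤ Λ.cap) {c : Cfg} (hc : Λ.Valid c) {Y : List Bool}
    (hY : Y.length = Λ.Nc) :
    (stepTpl Λ P).eval (wordAssign Λ.Nc (Λ.enc c) Y) = true ↔ Y = Λ.enc (step P c) := by
  have hpc : c.1 ≤ Λ.H := hc.1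
  have hlen : c.2.length = Λ.K := hc.2.1
  rw [eval_stepTpl_iff hpc]
  rcases Nat.lt_or_ge c.1 P.length with hlt | hge
  · have hi : P[c.1]? = some P[c.1] := List.getElem?_eq_getElem hlt
    rw [caseAt_of_some hi, step_of_getElem? hi]
    cases P[c.1] with
    | goto j =>
      rw [caseInstr, PropForm.eval, Bool.and_eq_true, pc_allRegs_iff hY c j rfl]
      rfl
    | push k a j =>
      by_cases hk : k < Λ.K
      · rw [push_iff hY hc hcap hk]; rfl
      · rw [caseInstr, if_neg hk, PropForm.eval, Bool.and_eq_true,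
          pc_allRegs_iff hY c j (S' := c.2.modify k (a :: ·))
            (Λ.regs_congr fun k' hk' => Lay.getD_modify_of_ne _ _ (by rw [List.mem_range] at hk'; omega))]
        rfl
    | pop k t =>
      by_cases hk : k < Λ.K
      · rw [pop_iff hY hc hcap hk]; rfl
      · have hnil : c.2.getD k [] = [] := List.getD_eq_default _ _ (by omega)
        rw [caseInstr, if_neg hk, PropForm.eval, Bool.and_eq_true,
          pc_allRegs_iff hY c (t.getD 0 0) (S' := c.2.set k (c.2.getD k []).tail)
            (Λ.regs_congr fun k' hk' => Lay.getD_set_of_ne _ _ (by rw [List.mem_range] at hk'; omega))]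
        simp only [Instr.apply, hnil, List.head?_nil, tblIdx, List.tail_nil]
  · have hnone : P[c.1]? = none := List.getElem?_eq_none hge
    rw [caseAt_of_none hnone, halt_iff hY c, step_of_le hge]

end StepSem

/-! ### Iterating the step: the doubling relation -/

section ReachSem

variable {Λ : Lay} {P : Prog}

variable (Λ P) in
/-- The step relation on words, as read by the Savitch formula of part I. [folklore] -/
def StepW (X Y : List Bool) : Prop := (stepTpl Λ P).eval (wordAssign Λ.Nc X Y) = true

/-- **`2^ℓ` steps by doubling**: along a valid run, the relation `Reach` of part I holds of
`(enc c, Y)` at level `ℓ` iff `Y` codes the configuration after `2^ℓ` steps.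
[cite: AroraBarakCC2009, Thm. 4.13 (proof: "ψᵢ(C, C') … path of length 2ⁱ")] -/
theorem reach_iff (hcap : 1 ≤ Λ.cap) : ∀ (ℓ : ℕ) (c : Cfg), (∀ m ≤ 2 ^ ℓ, Λ.Valid ((step P)^[m] c)) →
    ∀ (Y : List Bool), Y.length = Λ.Nc → (Reach Λ.Nc (StepW Λ P) ℓ (Λ.enc c) Y ↔ Y = Λ.enc ((step P)^[2 ^ ℓ] c))
  | 0, c, hv, Y, hY => by
    rw [Reach, StepW, stepTpl_iff hcap (by simpa using hv 0 (Nat.zero_le _)) hY, pow_zero, Function.iterate_one]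
  | ℓ + 1, c, hv, Y, hY => by
    have h2 : 2 ^ (ℓ + 1) = 2 ^ ℓ + 2 ^ ℓ := by rw [pow_succ]; ring
    have hv₁ : ∀ m ≤ 2 ^ ℓ, Λ.Valid ((step P)^[m] c) := fun m hm => hv m (by omega)
    have hv₂ : ∀ m ≤ 2 ^ ℓ, Λ.Valid ((step P)^[m] ((step P)^[2 ^ ℓ] c)) := fun m hm => by
      rw [← Function.iterate_add_apply]; exact hv _ (by omega)
    rw [Reach]
    constructor
    · rintro ⟨Z, hZ, h₁, h₂⟩
      rw [reach_iff hcap ℓ c hv₁ Z hZ] at h₁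
      subst h₁
      rw [reach_iff hcap ℓ _ hv₂ Y hY] at h₂
      rw [h₂, ← Function.iterate_add_apply, ← h2]
    · intro h
      refine ⟨Λ.enc ((step P)^[2 ^ ℓ] c), Λ.length_enc _, (reach_iff hcap ℓ c hv₁ _ (Λ.length_enc _)).2 rfl, ?_⟩
      rw [reach_iff hcap ℓ _ hv₂ Y hY, h, h2, Function.iterate_add_apply]

/-- **A halting valid run halts within `2^{Nc}` steps**: the configurations before halting are
pairwise distinct (a repetition would make the run periodic, never reaching the halting counter)
and are injectively coded by words of `Nc` bits. [cite: AroraBarakCC2009, Thm. 4.2 and Rem. 4.3 ("if the machine does not halt within 2^{O(S(n))} steps then it never will")] -/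
theorem haltTime_le {c₀ : Cfg} {n H : ℕ} (hrun : ∀ m < n, ((step P)^[m] c₀).1 < H) (hfix : ((step P)^[n] c₀).1 = H)
    (hv : ∀ m, Λ.Valid ((step P)^[m] c₀)) : n ≤ 2 ^ Λ.Nc := by
  have hinj : ∀ i j, i < n → j < n → (step P)^[i] c₀ = (step P)^[j] c₀ → i = j := by
    intro i j hi hj h
    by_contra hne
    wlog hij : i < j generalizing i j
    · exact this j i hj hi h.symm (Ne.symm hne) (by omega)
    have e : (step P)^[n - j + i] c₀ = (step P)^[n - j + j] c₀ := by
      rw [Function.iterate_add_apply, Function.iterate_add_apply, h]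
    rw [show n - j + j = n by omega] at e
    have h1 := hrun (n - j + i) (by omega)
    rw [e, hfix] at h1
    exact lt_irrefl _ h1
  let f : Fin n → (Fin Λ.Nc → Bool) := fun m q => (Λ.enc ((step P)^[m.1] c₀)).getD q.1 false
  have hf : Function.Injective f := by
    intro i j h
    refine Fin.ext (hinj _ _ i.2 j.2 (Λ.enc_injective (hv _) (hv _) ?_))
    refine List.ext_getElem (by simp) fun q hq hq' => ?_
    have e := congrFun h ⟨q, by simpa using hq⟩
    simp only [f] at e
    rwa [List.getD_eq_getElem _ _ hq, List.getD_eq_getElem _ _ hq'] at e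
  simpa using Fintype.card_le_of_injective f hf

end ReachSem

/-! ### The acceptance template -/

section Acc

variable {Λ : Lay}

variable (Λ) in
/-- **The acceptance template** on one block: the output stack `k₁` reads exactly `[acc]`, i.e.
its top cell holds `acc` and its second cell is empty (`⊥` if `k₁` is not a stack or the layout has
fewer than two cells). [cite: AroraBarakCC2009, Thm. 4.13 (proof: "plugging in … C_accept")] -/
def accTpl (k₁ acc : ℕ) : PropForm ℕ :=
  if k₁ < Λ.K ∧ 2 ≤ Λ.cap then
    .conj (vecConst (Λ.off k₁ 0) (onehot Λ.Wc (acc + 1))) (vecConst (Λ.off k₁ 1) (onehot Λ.Wc 0))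
  else .const false

variable (Λ) in
/-- The acceptance predicate on words. [folklore] -/
def AccW (k₁ acc : ℕ) (X : List Bool) : Prop := (accTpl Λ k₁ acc).eval (fun v => X.getD v false) = true

/-- Reading blocks of a word. [folklore] -/
theorem readVec_getD {X : List Bool} {a n : ℕ} (h : a + n ≤ X.length) :
    readVec (fun v => X.getD v false) a n = sl X a n := by
  refine List.ext_getElem (by rw [length_readVec, length_sl h]) fun j hj _ => ?_
  rw [length_readVec] at hj
  rw [getElem_readVec, List.getD_eq_getElem _ _ (by omega)]
  simp [sl, List.getElem_drop, List.getElem_take]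

/-- Dropping whole cells of a region. [folklore] -/
theorem drop_flatten_of_length_eq {α : Type} {b : ℕ} : ∀ (L : List (List α)) (n : ℕ), (∀ l ∈ L, l.length = b) →
    L.flatten.drop (n * b) = (L.drop n).flatten
  | [], n, _ => by simp
  | l :: L, 0, _ => by simp
  | l :: L, n + 1, h => by
    have hl : l.length = b := h l (by simp)
    rw [List.flatten_cons, show (n + 1) * b = l.length + n * b by rw [hl]; ring, ← List.drop_drop, List.drop_left,
      drop_flatten_of_length_eq L n (fun l' hl' => h l' (by simp [hl'])), List.drop_succ_cons]

/-- **Cell `i` of stack `k` in the coding.** [folklore] -/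
theorem sl_enc_cell (c : Cfg) {k i : ℕ} (hk : k < Λ.K) (hi : i < Λ.cap) :
    sl (Λ.enc c) (Λ.off k i) Λ.Wc = onehot Λ.Wc (cellVal (c.2.getD k []) i) := by
  have hi' : i * Λ.Wc + Λ.Wc ≤ Λ.Wr := by
    rw [Lay.Wr, ← Nat.succ_mul]; exact Nat.mul_le_mul_right _ hi
  rw [show Λ.off k i = Λ.off k 0 + i * Λ.Wc by simp [Lay.off], Λ.enc_eq_append c hk, List.append_assoc,
    List.append_assoc, off_zero_eq_lengths c k, Nat.add_assoc, sl_append_add, sl_append_add, sl_append_left (by simpa using hi'),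
    sl, Lay.reg, drop_flatten_of_length_eq _ _ (by simp), ← List.map_drop, List.drop_eq_getElem_cons (by simpa using hi),
    List.map_cons, List.flatten_cons, List.take_left' (length_onehot _ _), List.getElem_range]

end Acc

section AccSem

variable {Λ : Lay}

/-- A stack reads `[acc]` iff its top cell holds `acc` and its second cell is empty. [folklore] -/
theorem eq_singleton_iff_cellVal (l : List ℕ) (acc : ℕ) : l = [acc] ↔ cellVal l 0 = acc + 1 ∧ cellVal l 1 = 0 := by
  constructor
  · rintro rfl; exact ⟨rfl, rfl⟩
  · rintro ⟨h0, h1⟩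
    match l, h0, h1 with
    | [], h0, _ => simp [cellVal] at h0
    | [a], h0, _ => simp only [cellVal_cons_zero, Nat.add_right_cancel_iff] at h0; rw [h0]
    | a :: b :: l, _, h1 => simp [cellVal] at h1

/-- **Semantics of the acceptance template** on the coding of a valid configuration (layout with
at least two cells per stack): the output stack reads `[acc]`. [cite: AroraBarakCC2009, Thm. 4.13 (proof)] -/
theorem accW_enc_iff (hcap : 2 ≤ Λ.cap) {c : Cfg} (hc : Λ.Valid c) (k₁ acc : ℕ) :
    AccW Λ k₁ acc (Λ.enc c) ↔ c.2.getD k₁ [] = [acc] := by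
  unfold AccW accTpl
  by_cases hk : k₁ < Λ.K
  · rw [if_pos ⟨hk, hcap⟩]
    have a2 := off_succ_add_after hk
    have a3 : Λ.off k₁ 1 + Λ.Wc ≤ Λ.off (k₁ + 1) 0 := by
      rw [← off_add_Wr, Lay.off_succ, Lay.Wr, Nat.add_assoc, ← Nat.two_mul]
      exact Nat.add_le_add_left (Nat.mul_le_mul_right _ hcap) _
    have hb : ∀ a ∈ c.2.getD k₁ [], a ≤ Λ.N := by
      have hmem : c.2.getD k₁ [] ∈ c.2 := by
        rw [List.getD_eq_getElem _ _ (by rw [hc.2.1]; exact hk)]; exact List.getElem_mem _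
      exact (hc.2.2 _ hmem).2
    have hv0 : cellVal (c.2.getD k₁ []) 0 < Λ.Wc := by have := cellVal_le hb 0; simp only [Lay.Wc]; omega
    have hv1 : cellVal (c.2.getD k₁ []) 1 < Λ.Wc := by have := cellVal_le hb 1; simp only [Lay.Wc]; omega
    have h1 : Λ.off k₁ 1 + Λ.Wc ≤ Λ.Nc := by omega
    have h0 : Λ.off k₁ 0 + Λ.Wc ≤ Λ.Nc := by rw [Lay.off_succ] at a3; omega
    rw [PropForm.eval, Bool.and_eq_true, eval_vecConst, eval_vecConst, length_onehot, length_onehot,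
      readVec_getD (by rw [Lay.length_enc]; exact h0), readVec_getD (by rw [Lay.length_enc]; exact h1),
      sl_enc_cell c hk (by omega), sl_enc_cell c hk (by omega), eq_singleton_iff_cellVal]
    constructor
    · rintro ⟨h0, h1⟩; exact ⟨onehot_inj hv0 h0, onehot_inj hv1 h1⟩
    · rintro ⟨h0, h1⟩; rw [h0, h1]; exact ⟨rfl, rfl⟩
  · rw [if_neg (fun h => hk h.1), List.getD_eq_default _ _ (by rw [hc.2.1]; omega)]
    simp [PropForm.eval]

/-- Variable bound of the acceptance template. [folklore] -/
theorem propFormVarBound_accTpl_le (k₁ acc : ℕ) : propFormVarBound (accTpl Λ k₁ acc) ≤ Λ.Nc := by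
  unfold accTpl
  split
  · rename_i h
    have a2 := off_succ_add_after h.1
    have a3 : Λ.off k₁ 1 + Λ.Wc ≤ Λ.off (k₁ + 1) 0 := by
      rw [← off_add_Wr, Lay.off_succ, Lay.Wr, Nat.add_assoc, ← Nat.two_mul]
      exact Nat.add_le_add_left (Nat.mul_le_mul_right _ h.2) _
    simp only [propFormVarBound, max_le_iff]
    refine ⟨(propFormVarBound_vecConst_le _ _).trans ?_, (propFormVarBound_vecConst_le _ _).trans ?_⟩
    · rw [length_onehot]; rw [Lay.off_succ] at a3; omega
    · rw [length_onehot]; omega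
  · simp [propFormVarBound]

end AccSem

/-! ### Variable bound of the step template -/

section Bounds

variable {Λ : Lay} {P : Prog}

/-- Variable bound of `pcIs`. [folklore] -/
theorem propFormVarBound_pcIs_le (j : ℕ) : propFormVarBound (pcIs Λ Λ.Nc j) ≤ 2 * Λ.Nc :=
  (propFormVarBound_vecConst_le _ _).trans (by rw [length_onehot, Lay.Nc]; omega)

/-- Variable bound of `allRegsEq`. [folklore] -/
theorem propFormVarBound_allRegsEq_le : propFormVarBound (allRegsEq Λ) ≤ 2 * Λ.Nc :=
  (propFormVarBound_vecEq_le _ _ _).trans (by rw [Lay.Nc]; omega)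

/-- Variable bound of one instruction's constraint. [folklore] -/
theorem propFormVarBound_caseInstr_le (hcap : 1 ≤ Λ.cap) (i : Instr) : propFormVarBound (caseInstr Λ i) ≤ 2 * Λ.Nc := by
  have a3 := Wc_add_rest hcap
  cases i with
  | goto j =>
    rw [caseInstr, propFormVarBound]
    exact max_le (propFormVarBound_pcIs_le j) propFormVarBound_allRegsEq_le
  | push k a j =>
    rw [caseInstr]
    split
    · rename_i hk
      have a1 := off_add_Wr (Λ := Λ) k
      have a2 := off_succ_add_after hk
      have a4 : Λ.off k 0 = Λ.H + 1 + k * Λ.Wr := Λ.off_zero k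
      simp only [propFormVarBound, max_le_iff, beforeEq, afterEq]
      refine ⟨propFormVarBound_pcIs_le j, (propFormVarBound_vecEq_le _ _ _).trans (by omega),
        (propFormVarBound_vecConst_le _ _).trans (by rw [length_onehot]; omega),
        (propFormVarBound_vecEq_le _ _ _).trans (by omega), (propFormVarBound_vecEq_le _ _ _).trans (by omega)⟩
    · rw [propFormVarBound]
      exact max_le (propFormVarBound_pcIs_le j) propFormVarBound_allRegsEq_le
  | pop k t =>
    rw [caseInstr]
    split
    · rename_i hk
      have a1 := off_add_Wr (Λ := Λ) k
      have a2 := off_succ_add_after hk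
      have a4 : Λ.off k 0 = Λ.H + 1 + k * Λ.Wr := Λ.off_zero k
      simp only [propFormVarBound, max_le_iff, beforeEq, afterEq]
      refine ⟨(propFormVarBound_vecEq_le _ _ _).trans (by omega), (propFormVarBound_vecEq_le _ _ _).trans (by omega),
        (propFormVarBound_vecConst_le _ _).trans (by rw [length_onehot]; omega),
        (propFormVarBound_vecEq_le _ _ _).trans (by omega), propFormVarBound_bigConj_le fun φ hφ => ?_⟩
      simp only [List.mem_map, List.mem_range] at hφ
      obtain ⟨v, hv, rfl⟩ := hφ
      rw [propFormVarBound_impF, propFormVarBound]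
      exact max_le (by omega) (propFormVarBound_pcIs_le _)
    · rw [propFormVarBound]
      exact max_le (propFormVarBound_pcIs_le _) propFormVarBound_allRegsEq_le

/-- **Variable bound of the step template**: `2 Nc`. [folklore] -/
theorem propFormVarBound_stepTpl_le (hcap : 1 ≤ Λ.cap) : propFormVarBound (stepTpl Λ P) ≤ 2 * Λ.Nc := by
  refine propFormVarBound_bigConj_le fun φ hφ => ?_
  simp only [List.mem_map, List.mem_range] at hφ
  obtain ⟨p, hp, rfl⟩ := hφ
  rw [propFormVarBound_impF, propFormVarBound]
  refine max_le (by rw [Lay.Nc]; omega) ?_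
  unfold caseAt
  split
  · exact propFormVarBound_caseInstr_le hcap _
  · exact (propFormVarBound_vecEq_le _ _ _).trans (by omega)

end Bounds

/-! ### The flat QBF of a flat witness -/

section Witness

variable {L : Language Bool} (W : FlatWitness L)

/-- A member of a stack list is no longer than the total size. [folklore] -/
theorem length_le_sz_of_mem {S : List (List ℕ)} {l : List ℕ} (h : l ∈ S) : l.length ≤ sz S := by
  induction S with
  | nil => simp at h
  | cons l' S ih =>
    rw [sz_cons]
    rcases List.mem_cons.1 h with rfl | h
    · omega
    · exact (ih h).trans (by omega)

/-- **The layout of a flat witness** on inputs of length `n`: program length, stacks, symbols as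
given, and `bound n + 2` cells per stack. [cite: AroraBarakCC2009, Thm. 4.13 (proof: "m = O(S(n))")] -/
noncomputable def layW (n : ℕ) : Lay := ⟨W.P.length, W.K, W.N, W.bound.eval n + 2⟩

/-- The configuration of the run of the witness on `x` at time `m`. [folklore] -/
def cfgW (x : List Bool) (m : ℕ) : Cfg := (step W.P)^[m] (W.pc₀, initStk W.K W.k₀ W.code x)

/-- **The run stays valid** for the layout of its input length. [cite: AroraBarakCC2009, Def. 4.1] -/
theorem valid_cfgW (x : List Bool) (m : ℕ) : (layW W x.length).Valid (cfgW W x m) := by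
  refine ⟨W.fst_le x m, W.length_eq x m, fun l hl => ⟨?_, fun a ha => W.stkBound x m l hl a ha⟩⟩
  have h1 := length_le_sz_of_mem hl
  have h2 := W.sz_le x m
  change l.length ≤ W.bound.eval x.length + 2
  unfold cfgW at h1
  omega

/-- Iterates of the run. [folklore] -/
theorem cfgW_add (x : List Bool) (m m' : ℕ) : (step W.P)^[m] (cfgW W x m') = cfgW W x (m + m') := by
  rw [cfgW, cfgW, Function.iterate_add_apply]

/-- **The prenex QBF of the reduction at input `x`**: the Savitch formula of part I over the step
and acceptance templates of the layout of `|x|`, from the coding of the initial configuration,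
with `Nc` doubling levels. [cite: AroraBarakCC2009, Thm. 4.13 (proof, second half)] -/
noncomputable def flatQBF (x : List Bool) : PrenexQBF :=
  savitchQBF (ofTpl (layW W x.length).Nc (stepTpl (layW W x.length) W.P)) (ofTpl₁ (accTpl (layW W x.length) W.k₁ W.acc))
    ((layW W x.length).enc (cfgW W x 0)) (layW W x.length).Nc (layW W x.length).Nc

/-- The layout has at least two cells per stack. [folklore] -/
theorem two_le_cap_layW (n : ℕ) : 2 ≤ (layW W n).cap := Nat.le_add_left _ _

/-- **Correctness of the reduction**: `x ∈ L` iff the flat QBF of `x` is true. The formula is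
true iff the configuration after `2^{Nc}` steps has output stack `[acc]` (parts I–III); the run
halts, within `2^{Nc}` steps (`haltTime_le`), stays put afterwards, and accepts iff `x ∈ L`
(the flat witness). [cite: AroraBarakCC2009, Thm. 4.13 (proof: "true iff M accepts x")] -/
theorem mem_iff_isTrue_flatQBF (x : List Bool) : x ∈ L ↔ (flatQBF W x).IsTrue := by
  set Λ := layW W x.length with hΛ
  have hcap1 : 1 ≤ Λ.cap := (Nat.le_succ 1).trans (two_le_cap_layW W _)
  have hΦ : ∀ σ a b, (ofTpl Λ.Nc (stepTpl Λ W.P) a b).eval σ = true ↔ StepW Λ W.P (readVec σ a Λ.Nc) (readVec σ b Λ.Nc) :=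
    fun σ a b => by rw [eval_ofTpl (propFormVarBound_stepTpl_le hcap1)]; rfl
  have hacc : ∀ σ a, (ofTpl₁ (accTpl Λ W.k₁ W.acc) a).eval σ = true ↔ AccW Λ W.k₁ W.acc (readVec σ a Λ.Nc) :=
    fun σ a => by rw [eval_ofTpl₁ (propFormVarBound_accTpl_le _ _)]; rfl
  rw [flatQBF, ← hΛ, isTrue_savitchQBF_iff (StepW Λ W.P) (AccW Λ W.k₁ W.acc) hΦ hacc (Λ.length_enc _)]
  have hreach : ∀ Y : List Bool, Y.length = Λ.Nc →
      (Reach Λ.Nc (StepW Λ W.P) Λ.Nc (Λ.enc (cfgW W x 0)) Y ↔ Y = Λ.enc (cfgW W x (2 ^ Λ.Nc))) := fun Y hY => by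
    rw [reach_iff hcap1 Λ.Nc (cfgW W x 0) (fun m _ => by rw [cfgW_add]; exact valid_cfgW W x _) Y hY, cfgW_add, Nat.add_zero]
  obtain ⟨n, hrun, hfix, hpc, hiff⟩ := W.halts x
  have hn : n ≤ 2 ^ Λ.Nc := haltTime_le (c₀ := cfgW W x 0) (P := W.P) (H := W.P.length)
    (fun m hm => by rw [cfgW_add]; exact hrun m hm) (by rw [cfgW_add]; exact hpc) fun m => by
      rw [cfgW_add]; exact valid_cfgW W x _
  have hend : cfgW W x (2 ^ Λ.Nc) = cfgW W x n := hfix _ hn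
  rw [hiff]
  change (cfgW W x n).2.getD W.k₁ [] = [W.acc] ↔ _
  constructor
  · intro h
    refine ⟨Λ.enc (cfgW W x (2 ^ Λ.Nc)), Λ.length_enc _, ?_, (hreach _ (Λ.length_enc _)).2 rfl⟩
    rw [accW_enc_iff (two_le_cap_layW W _) (valid_cfgW W x _), hend]
    exact h
  · rintro ⟨C, hC, hA, hR⟩
    rw [hreach C hC] at hR
    subst hR
    rwa [accW_enc_iff (two_le_cap_layW W _) (valid_cfgW W x _), hend] at hA

/-- **The flat QBF is closed.** [cite: AroraBarakCC2009, Def. 4.10] -/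
theorem isClosed_flatQBF (x : List Bool) : (flatQBF W x).IsClosed := by
  have hcap1 : 1 ≤ (layW W x.length).cap := (Nat.le_succ 1).trans (two_le_cap_layW W _)
  exact isClosed_savitchQBF (propFormVarBound_ofTpl_le (propFormVarBound_stepTpl_le hcap1))
    (propFormVarBound_ofTpl₁_le (propFormVarBound_accTpl_le _ _)) (by rw [Lay.length_enc])

/-- Hence: **`x ∈ L` iff the code of the flat QBF of `x` is in `TQBF`.** [cite: AroraBarakCC2009, Thm. 4.13] -/
theorem mem_iff_encode_flatQBF_mem_TQBF (x : List Bool) : x ∈ L ↔ (flatQBF W x).encode ∈ TQBF := by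
  rw [encode_mem_TQBF_iff, mem_iff_isTrue_flatQBF W x]
  exact ⟨fun h => ⟨isClosed_flatQBF W x, h⟩, fun h => h.2⟩

end Witness

end TQBFRed

end Literature.Barriers.QuantumAdvantage
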